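import Mathlib
import HarnessLib

/-!
# Graded finiteness: degree-zero subalgebras and standard-graded Veronese pieces

Topic: `Summits/ResolutionOfSingularities/ResolutionOfSingularities/Theorems`. Stub
`stub_gradedFiniteness` of the line `Sketch` of the crux `Theses.WeightedInvariant.DatumToEmbedded`
(statement `stmt-ResolutionOfSingularities-0572`) of the summit
`Summit.ResolutionOfSingularities.ResolutionOfSingularities`: the pure commutative algebra that
the quotient step of the cobordant tower consumes to choose the Veronese degree of the downstairs
blow-up centre.

Two folklore facts about a finitely generated commutative algebra `A` over a commutative ring `C`
that is graded (`GradedAlgebra`) by submodules: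

1. **Invariants of a diagonalizable group are finitely generated.** If `A` is graded by an
   abelian group `M` (a `𝔾ₘʲ`/diagonalizable action), the degree-`0` subalgebra `A₀` is a
   finitely generated `C`-algebra (`finiteType_gradeZero`). Proof: choose finitely many
   homogeneous generators `xᵢ` of degrees `eᵢ` (homogeneous components of any finite generating
   set, `exists_homogeneous_generators`); every graded piece `A_μ` is the `C`-span of the
   monomials `∏ xᵢ ^ αᵢ` of weight `∑ αᵢ • eᵢ = μ` (`le_span_monomials`, by projecting a
   `C`-combination of monomials to degree `μ`); the exponent vectors of weight `0` form a
   submonoid of `ℕ^ι` generated by its minimal non-zero elements, a finite set by Dickson's lemma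
   (`exists_finite_weightZero_generators`, Mathlib's `Pi.wellQuasiOrderedLE`); hence `A₀` is
   generated by the finitely many corresponding monomials.
2. **Some Veronese subring is standard graded** (Bourbaki, *Algèbre commutative* III §1 no. 3,
   Prop. 3; EGA II 2.1.6). If `S` is `ℕ`-graded there is `d > 0` with
   `S_{d(l+1)} = S_d · S_{dl}` for all `l` (`exists_veronese_mul_eq`). Proof: with homogeneous
   generators of degrees `eᵢ`, `h := (∑ eᵢ)!` is a positive common multiple of the positive
   degrees and, for `n + h ≥ (#ι) · h`, every monomial of weight `n + h` contains a factor
   `xᵢ ^ (h / eᵢ)` of weight exactly `h` (pigeonhole), so `S_{n+h} ≤ S_h · S_n`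
   (`piece_add_le_mul`); iterating, `d := (#ι + 1) · h` works.

Only Mathlib is used. The final statement `stub_gradedFiniteness` is the registered conjunction
of the two facts (all types in `Type`).
-/

-- the summit namespace repeats `ResolutionOfSingularities` by design (mandated namespace)
set_option linter.dupNamespace false

namespace Summit.ResolutionOfSingularities.ResolutionOfSingularities.Theorems.DatumToEmbedded.GradedFiniteness

open DirectSum

/-! ## Homogeneous generators and monomials -/

section Monomials

variable {C A M : Type} [CommRing C] [CommRing A] [Algebra C A] [DecidableEq M] [AddCommMonoid M]
  (𝒜 : M → Submodule C A) [GradedAlgebra 𝒜]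

/-- A finitely generated graded algebra has a finite family of **homogeneous** generators: the
homogeneous components of the members of any finite generating set. [folklore] -/
theorem exists_homogeneous_generators (h : Algebra.FiniteType C A) :
    ∃ (ι : Type) (_ : Fintype ι) (x : ι → A) (e : ι → M),
      (∀ i, x i ∈ 𝒜 (e i)) ∧ Algebra.adjoin C (Set.range x) = ⊤ := by
  classical
  obtain ⟨s, hs⟩ := h.out
  refine ⟨(a : ↥s) × ↥(decompose 𝒜 (a : A)).support, inferInstance,
    fun p => (decompose 𝒜 (p.1 : A) (p.2 : M) : A), fun p => (p.2 : M),
    fun p => SetLike.coe_mem _, ?_⟩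
  rw [eq_top_iff, ← hs]
  refine Algebra.adjoin_le fun a ha => ?_
  rw [SetLike.mem_coe, ← sum_support_decompose 𝒜 a]
  exact Subalgebra.sum_mem _ fun μ hμ => Algebra.subset_adjoin ⟨⟨⟨a, ha⟩, ⟨μ, hμ⟩⟩, rfl⟩

variable {ι : Type} [Fintype ι] (x : ι → A) (e : ι → M)

/-- A monomial `∏ xᵢ ^ αᵢ` in homogeneous elements `xᵢ ∈ A_{eᵢ}` is homogeneous of degree
`∑ αᵢ • eᵢ`. [folklore] -/
theorem prod_pow_mem (hx : ∀ i, x i ∈ 𝒜 (e i)) (α : ι → ℕ) :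
    ∏ i, x i ^ α i ∈ 𝒜 (∑ i, α i • e i) :=
  SetLike.prod_mem_graded 𝒜 (fun i => α i • e i) (fun i => x i ^ α i) fun i _ =>
    SetLike.pow_mem_graded (α i) (hx i)

/-- If homogeneous elements `xᵢ ∈ A_{eᵢ}` generate `A` as a `C`-algebra, then every graded piece
`A_μ` is contained in the `C`-span of the monomials `∏ xᵢ ^ αᵢ` of weight `∑ αᵢ • eᵢ = μ`:
project a `C`-combination of monomials onto degree `μ`. [folklore] -/
theorem le_span_monomials (hx : ∀ i, x i ∈ 𝒜 (e i))
    (hgen : Algebra.adjoin C (Set.range x) = ⊤) (μ : M) :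
    𝒜 μ ≤ Submodule.span C
      ((fun α : ι → ℕ => ∏ i, x i ^ α i) '' {α | ∑ i, α i • e i = μ}) := by
  intro r hr
  have hr' : r ∈ Subalgebra.toSubmodule (Algebra.adjoin C (Set.range x)) := by
    rw [hgen, Algebra.top_toSubmodule]
    exact Submodule.mem_top
  rw [Algebra.adjoin_eq_span] at hr'
  have key : Submodule.span C (Submonoid.closure (Set.range x) : Set A) ≤
      (Submodule.span C ((fun α : ι → ℕ => ∏ i, x i ^ α i) '' {α | ∑ i, α i • e i = μ})).comap
        (GradedAlgebra.proj 𝒜 μ) := by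
    refine Submodule.span_le.2 fun m hm => ?_
    obtain ⟨α, rfl⟩ := Submonoid.mem_closure_range_iff_of_fintype.1 hm
    simp only [SetLike.mem_coe, Submodule.mem_comap, GradedAlgebra.proj_apply]
    by_cases hα : ∑ i, α i • e i = μ
    · rw [decompose_of_mem_same 𝒜 (hα ▸ prod_pow_mem 𝒜 x e hx α)]
      exact Submodule.subset_span ⟨α, hα, rfl⟩
    · rw [decompose_of_mem_ne 𝒜 (prod_pow_mem 𝒜 x e hx α) hα]
      exact zero_mem _
  have hmem := key hr'
  rw [Submodule.mem_comap, GradedAlgebra.proj_apply, decompose_of_mem_same 𝒜 hr] at hmem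
  exact hmem

end Monomials

/-! ## Part 1: the degree-zero subalgebra is of finite type -/

section DegreeZero

/-- **Dickson/Gordan for weight-zero exponents.** For weights `eᵢ` in a commutative monoid, the
exponent vectors `α : ι → ℕ` (finite `ι`) of weight `∑ αᵢ • eᵢ = 0` all lie in the submonoid
generated by a *finite* set of such vectors, namely the minimal non-zero ones (an antichain of
`ℕ^ι`, finite by Dickson's lemma; if `β ≤ α` both have weight `0` then so does `α - β`).
[folklore] -/
theorem exists_finite_weightZero_generators {ι M : Type} [Fintype ι] [AddCommMonoid M]
    (e : ι → M) :
    ∃ B : Set (ι → ℕ), B.Finite ∧ (∀ β ∈ B, ∑ i, β i • e i = 0) ∧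
      ∀ α : ι → ℕ, ∑ i, α i • e i = 0 → α ∈ AddSubmonoid.closure B := by
  refine ⟨{β | Minimal (fun γ : ι → ℕ => γ ≠ 0 ∧ ∑ i, γ i • e i = 0) β},
    WellQuasiOrderedLE.finite_of_isAntichain (setOf_minimal_antichain _),
    fun β hβ => (Minimal.prop (P := fun γ : ι → ℕ => γ ≠ 0 ∧ ∑ i, γ i • e i = 0) hβ).2,
    fun α => ?_⟩
  induction α using WellFoundedLT.induction with
  | ind α ih =>
    intro hα
    by_cases h0 : α = 0
    · rw [h0]
      exact zero_mem _
    obtain ⟨β, hβα, hβ⟩ :=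
      exists_minimal_le_of_wellFoundedLT (fun γ : ι → ℕ => γ ≠ 0 ∧ ∑ i, γ i • e i = 0) α ⟨h0, hα⟩
    have hsplit : α = β + (α - β) := funext fun i => (Nat.add_sub_cancel' (hβα i)).symm
    have hγ : ∑ i, (α - β) i • e i = 0 := by
      have h1 : ∑ i, α i • e i = ∑ i, β i • e i + ∑ i, (α - β) i • e i := by
        rw [← Finset.sum_add_distrib]
        refine Finset.sum_congr rfl fun i _ => ?_
        rw [← add_smul, Pi.sub_apply, Nat.add_sub_cancel' (hβα i)]
      rw [hα, hβ.prop.2, zero_add] at h1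
      exact h1.symm
    have hlt : α - β < α := by
      refine lt_of_le_of_ne (fun i => Nat.sub_le (α i) (β i)) fun heq => hβ.prop.1 ?_
      funext i
      have h1 : α i - β i = α i := congrFun heq i
      have h2 : β i ≤ α i := hβα i
      show β i = 0
      omega
    have hβmem : β ∈ AddSubmonoid.closure
        {β | Minimal (fun γ : ι → ℕ => γ ≠ 0 ∧ ∑ i, γ i • e i = 0) β} :=
      AddSubmonoid.subset_closure hβ
    have hmem := add_mem hβmem (ih _ hlt hγ)
    rwa [← hsplit] at hmem

/-- **Invariants of a diagonalizable group action on a finitely generated algebra are finitely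
generated**, graded form: if a finitely generated commutative `C`-algebra `R` is graded by an
abelian group `M`, its degree-`0` subalgebra `R₀` (with Mathlib's `SetLike.GradeZero` algebra
structure) is a finitely generated `C`-algebra. [folklore; Mumford, GIT, Thm 1.1, diagonalizable
case] -/
theorem finiteType_gradeZero {C R M : Type} [CommRing C] [CommRing R] [Algebra C R]
    [DecidableEq M] [AddCommGroup M] (ℛ : M → Submodule C R) [GradedAlgebra ℛ]
    (hR : Algebra.FiniteType C R) : Algebra.FiniteType C (ℛ 0) := by
  obtain ⟨ι, _, x, e, hx, hgen⟩ := exists_homogeneous_generators ℛ hR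
  obtain ⟨B, hBfin, hB0, hBgen⟩ := exists_finite_weightZero_generators e
  -- every monomial with exponent in the closure of `B` lies in the adjoin of the `B`-monomials
  have hadj : ∀ α : ι → ℕ, α ∈ AddSubmonoid.closure B →
      ∏ i, x i ^ α i ∈ Algebra.adjoin C ((fun β : ι → ℕ => ∏ i, x i ^ β i) '' B) := by
    intro α hα
    induction hα using AddSubmonoid.closure_induction with
    | mem β hβ => exact Algebra.subset_adjoin ⟨β, hβ, rfl⟩
    | zero => simpa only [Pi.zero_apply, pow_zero, Finset.prod_const_one] using Subalgebra.one_mem _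
    | add γ δ _ _ hγ hδ =>
      simpa only [Pi.add_apply, pow_add, Finset.prod_mul_distrib] using Subalgebra.mul_mem _ hγ hδ
  have heq : Algebra.adjoin C ((fun β : ι → ℕ => ∏ i, x i ^ β i) '' B) =
      SetLike.GradeZero.subalgebra ℛ := by
    refine le_antisymm (Algebra.adjoin_le ?_) fun r hr => ?_
    · rintro _ ⟨β, hβ, rfl⟩
      show ∏ i, x i ^ β i ∈ ℛ 0
      exact hB0 β hβ ▸ prod_pow_mem ℛ x e hx β
    · change r ∈ ℛ 0 at hr
      have hspan : Submodule.span C ((fun α : ι → ℕ => ∏ i, x i ^ α i) '' {α | ∑ i, α i • e i = 0})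
          ≤ Subalgebra.toSubmodule (Algebra.adjoin C ((fun β : ι → ℕ => ∏ i, x i ^ β i) '' B)) := by
        refine Submodule.span_le.2 ?_
        rintro _ ⟨α, hα, rfl⟩
        exact hadj α (hBgen α hα)
      exact hspan (le_span_monomials ℛ x e hx hgen 0 hr)
  have hFG : (SetLike.GradeZero.subalgebra ℛ).FG :=
    ⟨(hBfin.image _).toFinset, by rw [Set.Finite.coe_toFinset, heq]⟩
  exact (Subalgebra.fg_iff_finiteType _).1 hFG

end DegreeZero

/-! ## Part 2: some Veronese subring is standard graded -/

section Veronese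

variable {C S : Type} [CommRing C] [CommRing S] [Algebra C S] (𝒮 : ℕ → Submodule C S)
  [GradedAlgebra 𝒮]

/-- Graded multiplication at the level of pieces: `S_a · S_b ≤ S_{a+b}`. [folklore] -/
theorem mul_le_piece (a b : ℕ) : 𝒮 a * 𝒮 b ≤ 𝒮 (a + b) :=
  Submodule.mul_le.2 fun _ hm _ hn => SetLike.mul_mem_graded hm hn

/-- Graded powers at the level of pieces: `(S_a)^j ≤ S_{j a}`. [folklore] -/
theorem pow_le_piece (a : ℕ) : ∀ j : ℕ, 𝒮 a ^ j ≤ 𝒮 (j * a)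
  | 0 => by simpa only [pow_zero, zero_mul, Submodule.one_le] using SetLike.one_mem_graded 𝒮
  | j + 1 => by
    rw [pow_succ, add_one_mul]
    exact (mul_le_mul_left (pow_le_piece a j) _).trans (mul_le_piece 𝒮 _ _)

variable {ι : Type} [Fintype ι] (x : ι → S) (e : ι → ℕ)

/-- **Splitting off a factor of fixed degree** (EGA II 2.1.6): let homogeneous `xᵢ ∈ S_{eᵢ}`
generate `S`, and let `h > 0` be a common multiple of the positive `eᵢ`. If `n + h ≥ (#ι) · h`
then `S_{n+h} ≤ S_h · S_n`: a monomial of weight `n + h` has a factor `xᵢ ^ αᵢ` of weight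
`αᵢ eᵢ ≥ h` (pigeonhole), from which `xᵢ ^ (h / eᵢ) ∈ S_h` splits off. [folklore] -/
theorem piece_add_le_mul (hx : ∀ i, x i ∈ 𝒮 (e i)) (hgen : Algebra.adjoin C (Set.range x) = ⊤)
    {h : ℕ} (hh : 0 < h) (hdvd : ∀ i, 0 < e i → e i ∣ h) {n : ℕ}
    (hn : Fintype.card ι * h ≤ n + h) : 𝒮 (n + h) ≤ 𝒮 h * 𝒮 n := by
  classical
  refine (le_span_monomials 𝒮 x e hx hgen (n + h)).trans (Submodule.span_le.2 ?_)
  rintro _ ⟨α, hα : ∑ i, α i • e i = n + h, rfl⟩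
  show ∏ j, x j ^ α j ∈ 𝒮 h * 𝒮 n
  simp only [smul_eq_mul] at hα
  -- pigeonhole: some `xᵢ ^ αᵢ` has weight at least `h`
  have hne : (Finset.univ : Finset ι).Nonempty := by
    by_contra hempty
    rw [Finset.not_nonempty_iff_eq_empty.1 hempty, Finset.sum_empty] at hα
    omega
  have hle : ∑ _j : ι, h ≤ ∑ j, α j * e j := by
    rw [Finset.sum_const, Finset.card_univ, smul_eq_mul, hα]
    exact hn
  obtain ⟨i, -, hi : h ≤ α i * e i⟩ := Finset.exists_le_of_sum_le hne hle
  have hei : 0 < e i := Nat.pos_of_ne_zero fun h0 => by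
    rw [h0, mul_zero] at hi
    omega
  obtain ⟨g, hg⟩ := hdvd i hei
  have hge : g * e i = h := by
    rw [mul_comm]
    exact hg.symm
  have hgα : g ≤ α i := Nat.le_of_mul_le_mul_right (hge ▸ hi) hei
  -- split the monomial as `xᵢ ^ g` times the rest
  have hsplit : ∏ j, x j ^ α j =
      x i ^ g * (x i ^ (α i - g) * ∏ j ∈ Finset.univ.erase i, x j ^ α j) := by
    rw [← mul_assoc, ← pow_add, Nat.add_sub_cancel' hgα]
    exact (Finset.mul_prod_erase Finset.univ (fun j => x j ^ α j) (Finset.mem_univ i)).symm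
  rw [hsplit]
  refine Submodule.mul_mem_mul ?_ ?_
  · have h1 := SetLike.pow_mem_graded g (hx i)
    rwa [smul_eq_mul, hge] at h1
  · have h2 : x i ^ (α i - g) * ∏ j ∈ Finset.univ.erase i, x j ^ α j ∈
        𝒮 ((α i - g) • e i + ∑ j ∈ Finset.univ.erase i, α j • e j) :=
      SetLike.mul_mem_graded (SetLike.pow_mem_graded _ (hx i))
        (SetLike.prod_mem_graded 𝒮 (fun j => α j • e j) (fun j => x j ^ α j) fun j _ =>
          SetLike.pow_mem_graded _ (hx j))
    have hdeg : (α i - g) • e i + ∑ j ∈ Finset.univ.erase i, α j • e j = n := by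
      have hsum := Finset.add_sum_erase Finset.univ (fun j => α j * e j) (Finset.mem_univ i)
      rw [hα] at hsum
      simp only [smul_eq_mul]
      rw [tsub_mul]
      omega
    rwa [hdeg] at h2

/-- Iterating `piece_add_le_mul`: `S_{n + j h} ≤ (S_h)^j · S_n` as soon as `n ≥ (#ι) · h`.
[folklore] -/
theorem piece_add_mul_le (hx : ∀ i, x i ∈ 𝒮 (e i)) (hgen : Algebra.adjoin C (Set.range x) = ⊤)
    {h : ℕ} (hh : 0 < h) (hdvd : ∀ i, 0 < e i → e i ∣ h) {n : ℕ}
    (hn : Fintype.card ι * h ≤ n) : ∀ j : ℕ, 𝒮 (n + j * h) ≤ 𝒮 h ^ j * 𝒮 n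
  | 0 => by simp
  | j + 1 => by
    calc 𝒮 (n + (j + 1) * h) = 𝒮 (n + j * h + h) := by rw [add_one_mul, add_assoc]
      _ ≤ 𝒮 h * 𝒮 (n + j * h) := piece_add_le_mul 𝒮 x e hx hgen hh hdvd (by omega)
      _ ≤ 𝒮 h * (𝒮 h ^ j * 𝒮 n) :=
        mul_le_mul_right (piece_add_mul_le hx hgen hh hdvd hn j) _
      _ = 𝒮 h ^ (j + 1) * 𝒮 n := by rw [pow_succ', mul_assoc]

/-- **Some Veronese subring of a finitely generated `ℕ`-graded algebra is standard graded**
(Bourbaki, *Algèbre commutative* III §1 no. 3 Prop. 3; EGA II 2.1.6): there is `d > 0` with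
`S_{d(l+1)} = S_d · S_{dl}` for every `l`. [folklore] -/
theorem exists_veronese_mul_eq (hS : Algebra.FiniteType C S) :
    ∃ d : ℕ, 0 < d ∧ ∀ l : ℕ, 𝒮 (d * (l + 1)) = 𝒮 d * 𝒮 (d * l) := by
  obtain ⟨ι, _, x, e, hx, hgen⟩ := exists_homogeneous_generators 𝒮 hS
  have hh : 0 < (∑ i, e i).factorial := Nat.factorial_pos _
  have hdvd : ∀ i, 0 < e i → e i ∣ (∑ i, e i).factorial := fun i hi =>
    Nat.dvd_factorial hi (Finset.single_le_sum (fun j _ => Nat.zero_le (e j)) (Finset.mem_univ i))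
  refine ⟨(Fintype.card ι + 1) * (∑ i, e i).factorial, Nat.mul_pos (Nat.succ_pos _) hh,
    fun l => le_antisymm ?_ ?_⟩
  · rcases Nat.eq_zero_or_pos l with rfl | hl
    · intro s hs
      rw [zero_add, mul_one] at hs
      rw [mul_zero]
      simpa only [mul_one] using Submodule.mul_mem_mul hs (SetLike.one_mem_graded 𝒮)
    · have hn : Fintype.card ι * (∑ i, e i).factorial ≤
          (Fintype.card ι + 1) * (∑ i, e i).factorial * l :=
        calc Fintype.card ι * (∑ i, e i).factorial
            ≤ (Fintype.card ι + 1) * (∑ i, e i).factorial :=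
              Nat.mul_le_mul_right _ (Nat.le_succ _)
          _ ≤ (Fintype.card ι + 1) * (∑ i, e i).factorial * l := Nat.le_mul_of_pos_right _ hl
      calc 𝒮 ((Fintype.card ι + 1) * (∑ i, e i).factorial * (l + 1))
          = 𝒮 ((Fintype.card ι + 1) * (∑ i, e i).factorial * l +
              (Fintype.card ι + 1) * (∑ i, e i).factorial) := by rw [mul_add_one]
        _ ≤ 𝒮 ((∑ i, e i).factorial) ^ (Fintype.card ι + 1) *
              𝒮 ((Fintype.card ι + 1) * (∑ i, e i).factorial * l) :=
            piece_add_mul_le 𝒮 x e hx hgen hh hdvd hn _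
        _ ≤ _ := mul_le_mul_left (pow_le_piece 𝒮 _ _) _
  · calc 𝒮 ((Fintype.card ι + 1) * (∑ i, e i).factorial) *
          𝒮 ((Fintype.card ι + 1) * (∑ i, e i).factorial * l)
        ≤ 𝒮 ((Fintype.card ι + 1) * (∑ i, e i).factorial +
            (Fintype.card ι + 1) * (∑ i, e i).factorial * l) := mul_le_piece 𝒮 _ _
      _ = _ := by rw [mul_add_one, add_comm]

end Veronese

/-- STUB `stub_gradedFiniteness` of the line `Sketch` of the crux `DatumToEmbedded`
(stmt-ResolutionOfSingularities-0572), commutative algebra: (1) **invariants of a diagonalizable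
group are finitely generated** — the degree-`0` subalgebra of a finitely generated algebra graded
by an abelian group is finitely generated (`finiteType_gradeZero`: homogeneous generators, and the
monoid of weight-zero exponents is finitely generated by Dickson's lemma); (2) **some Veronese
subalgebra is standard graded** — for a finitely generated `ℕ`-graded algebra `S` there is `d > 0`
with `S_{d(l+1)} = S_d · S_{dl}` for all `l` (`exists_veronese_mul_eq`: generators of degrees
`eᵢ`, `h = (∑ eᵢ)!`, `d = (#ι + 1) · h`, pigeonhole). [folklore; Bourbaki, Alg. Comm. III §1
no. 3 Prop. 3; Mumford GIT Thm 1.1 (diagonalizable case)] -/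
theorem stub_gradedFiniteness :
    (∀ (C R : Type) [CommRing C] [CommRing R] [Algebra C R] (M : Type) [AddCommGroup M]
        [DecidableEq M] (ℛ : M → Submodule C R) [GradedAlgebra ℛ],
        Algebra.FiniteType C R → Algebra.FiniteType C (ℛ 0)) ∧
    (∀ (C S : Type) [CommRing C] [CommRing S] [Algebra C S] (𝒮 : ℕ → Submodule C S)
        [GradedAlgebra 𝒮], Algebra.FiniteType C S →
        ∃ d : ℕ, 0 < d ∧ ∀ l : ℕ, 𝒮 (d * (l + 1)) = 𝒮 d * 𝒮 (d * l)) :=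
  ⟨fun _ _ _ _ _ _ _ _ ℛ _ h => finiteType_gradeZero ℛ h,
    fun _ _ _ _ _ 𝒮 _ h => exists_veronese_mul_eq 𝒮 h⟩

end Summit.ResolutionOfSingularities.ResolutionOfSingularities.Theorems.DatumToEmbedded.GradedFiniteness
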